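import Literature.AlgebraicGeometry.AbelianSchemes.AbelianSchemeOverHomOfReduced
import Literature.AlgebraicGeometry.AbelianSchemes.AbelianSchemeDualPair
import Literature.AlgebraicGeometry.Modules.RankOneEndomorphismScalar
import Mathlib.AlgebraicGeometry.Fiber
import HarnessLib

/-!
# Over a REDUCED base: global functions and rigidified automorphisms on an abelian scheme are trivial

Layer `Literature/AlgebraicGeometry/AbelianSchemes`, namespace `Literature.AlgebraicGeometry.AbelianSchemes.AbelianSchemeOver`.
THEOREMS ONLY (no definition, no named fact, no instance).

For an abelian scheme `A → T` ([MumfordFogartyKirwan1994] Ch. 6 §1 Def. 6.1) over a REDUCED locally Noetherian base `T`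
(so that the total space of `A` is reduced: smooth over reduced, ★ `isReduced_left`, Stacks 034E), with unit section
`ε : T → A` (★ `unitSection`):

* §1 **functions** — `appTop_eq_zero_of_unitSection_appTop_eq_zero` / `appTop_eq_of_unitSection_appTop_eq`: a global
  function on `A` is determined by its restriction along `ε` (on each scheme-theoretic fibre `A_t`, an abelian variety over
  `κ(t)`, global functions are the constants — ★ `surjective_appTop_fiberToSpecResidueField`, [MumfordFogartyKirwan1994]
  Prop. 6.1 hypothesis / [Hartshorne1977] II Ex. 4.5(d) — so a function vanishing along `ε` vanishes on every fibre, hence at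
  every point, hence is `0` on the reduced `A`, Mathlib `basicOpen_eq_bot_iff`); **`appTop_hom_bijective`: `Γ(A, 𝒪_A) = Γ(T, 𝒪_T)`**
  (the Stein property of `A → T` on global sections, [MumfordAV1970] §5 Cor. 6 setting `p_*𝒪 = 𝒪`) and `eq_appTop_unitSection_appTop`.
* §2 **line bundles** — `eq_id_of_pullback_unitSection_map_eq_id`: an endomorphism `α` of a line bundle `E` on `A` (rank one)
  with `ε^*α = 𝟙` IS `𝟙` (every endomorphism of a rank-one module is multiplication by a global function, ★
  `exists_unique_eq_globalScalar`, [Hartshorne1977] II Ex. 5.1 (b); `ε^*(a·) = ε^♯(a)·`, ★ `pullback_map_globalScalar`; §1);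
  hence **`hom_eq_of_pullback_unitSection_map_eq`** (two morphisms `E → E′` of line bundles, the second invertible, with the
  same restriction along `ε` are equal) and the `Iso` forms `iso_eq_refl_of_pullback_unitSection_map_eq_id`,
  **`iso_eq_of_pullback_unitSection_map_eq`** — «RIGIDIFIED ISOMORPHISMS ARE UNIQUE over a reduced base»
  ([MumfordAV1970] §13 p. 125, the normalisation along the zero section; [MilneAV2008] I §8 pp. 36–37).

Cell `hodgecm-mathlib` (D-0151), HECKE-LINK H2 file (ii) «dual pair of the quotient» (B-p20 (g9) hand (P-St′) 20:36:33Z): consumers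
D3b (`hunit`/`hcocycle` of the `K′`-structure on `(π × 1)^*𝒫` over the reduced base `Â`), D6 (u2) uniqueness, and the (β)
«descended polarisation is unique» (B-p14 (g14)).  Count-neutral; HC_CM is proved only modulo the 7 printed citations until
rung 0 closes.

## References
* [MumfordFogartyKirwan1994] D. Mumford, J. Fogarty, F. Kirwan, *GIT* 3rd ed. (1994), Ch. 6 §1 Def. 6.1 (p. 115), Prop. 6.1
  (pp. 115–116: the hypothesis `H⁰(X_s, 𝒪_{X_s}) = κ(s)`).
* [MumfordAV1970] D. Mumford, *Abelian Varieties* (1970), §5 Cor. 6 (p. 54) (setting `p_*𝒪 = 𝒪`), §13 (p. 125).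
* [MilneAV2008] J. S. Milne, *Abelian Varieties* (v2.00, 2008), I §8 pp. 36–37 (rigidified families).
* [Hartshorne1977] R. Hartshorne, *Algebraic Geometry*, II Ex. 4.5(d), II Ex. 5.1 (b) (p. 123).
* The Stacks project, Tag 034E (smooth over reduced is reduced).
-/

set_option autoImplicit false

noncomputable section

universe u

open CategoryTheory CategoryTheory.Limits AlgebraicGeometry TopologicalSpace
open Literature.AlgebraicGeometry.Modules Literature.AlgebraicGeometry.Motives

namespace Literature.AlgebraicGeometry.AbelianSchemes

namespace AbelianSchemeOver

variable {T : Scheme.{u}} [IsReduced T] [IsLocallyNoetherian T] (A : AbelianSchemeOver T)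

/-! ## §1 Global functions on `A` are determined along the unit section; `Γ(A, 𝒪) = Γ(T, 𝒪)` -/

omit [IsReduced T] [IsLocallyNoetherian T] in
/-- On every scheme-theoretic fibre `A_t` (`t ∈ T`), a global function of `A` vanishing along the unit section vanishes:
`Γ(A_t, 𝒪) = κ(t)` (★ `surjective_appTop_fiberToSpecResidueField`) and the constant is read off at the origin `ε(t) ∈ A_t`.
[cite: MumfordFogartyKirwan1994, Ch. 6 §1 Proposition 6.1 (pp. 115–116), hypothesis] -/
theorem fiberι_appTop_eq_zero_of_unitSection_appTop_eq_zero (w : Γ(A.X.left, ⊤)) (h : A.unitSection.appTop w = 0)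
    (t : T) : (A.X.hom.fiberι t).appTop w = 0 := by
  obtain ⟨c, hc⟩ := A.surjective_appTop_fiberToSpecResidueField t ((A.X.hom.fiberι t).appTop w)
  -- the origin of the fibre: the section `ε_t : Spec κ(t) → A_t` induced by `ε`
  let εt : Spec (T.residueField t) ⟶ A.X.hom.fiber t :=
    pullback.lift (T.fromSpecResidueField t ≫ A.unitSection) (𝟙 _)
      (by rw [Category.assoc, A.unitSection_comp_hom, Category.comp_id, Category.id_comp])
  have h1 : εt ≫ A.X.hom.fiberι t = T.fromSpecResidueField t ≫ A.unitSection := pullback.lift_fst _ _ _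
  have h2 : εt ≫ A.X.hom.fiberToSpecResidueField t = 𝟙 _ := pullback.lift_snd _ _ _
  -- evaluate `hc : p^♯ c = ι^♯ w` at the origin: `c = ε_t^♯ ι^♯ w = (Spec κ(t) → T)^♯ (ε^♯ w) = 0`
  have e1 : εt.appTop ((A.X.hom.fiberToSpecResidueField t).appTop c) = c := by
    rw [← CommRingCat.comp_apply, ← Scheme.Hom.comp_appTop, h2, Scheme.Hom.id_appTop]
    rfl
  have e2 : εt.appTop ((A.X.hom.fiberι t).appTop w) = 0 := by
    rw [← CommRingCat.comp_apply, ← Scheme.Hom.comp_appTop, h1, Scheme.Hom.comp_appTop, CommRingCat.comp_apply, h,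
      map_zero]
  have hc0 : c = 0 := by rw [← e1, hc, e2]
  rw [← hc, hc0, map_zero]

/-- **A global function on an abelian scheme over a REDUCED locally Noetherian base which vanishes along the unit section
is zero**: it vanishes on every scheme-theoretic fibre (`fiberι_appTop_eq_zero_of_unitSection_appTop_eq_zero`), hence
`A.basicOpen w` has no point, and the total space is reduced (★ `isReduced_left`; Mathlib `basicOpen_eq_bot_iff`).
[cite: MumfordFogartyKirwan1994, Ch. 6 §1 Proposition 6.1 (pp. 115–116)] [cite: StacksProject, Tag 034E] -/
theorem appTop_eq_zero_of_unitSection_appTop_eq_zero (w : Γ(A.X.left, ⊤)) (h : A.unitSection.appTop w = 0) :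
    w = 0 := by
  haveI := A.isReduced_left
  have hbot : A.X.left.basicOpen w = ⊥ := by
    rw [← Opens.coe_inj, Opens.coe_bot, Set.eq_empty_iff_forall_notMem]
    intro z hz
    -- `z` lies on the fibre over `t := z ↦ T`, on which `w` restricts to `0`
    have hz' : A.X.hom.asFiber z ∈ (A.X.hom.fiberι (A.X.hom.base z)) ⁻¹ᵁ (A.X.left.basicOpen w) := by
      show (A.X.hom.fiberι _).base (A.X.hom.asFiber z) ∈ A.X.left.basicOpen w
      rw [A.X.hom.fiberι_asFiber]
      exact hz
    rw [Scheme.preimage_basicOpen] at hz'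
    have h0 : (A.X.hom.fiberι (A.X.hom.base z)).app ⊤ w = 0 :=
      A.fiberι_appTop_eq_zero_of_unitSection_appTop_eq_zero w h _
    rw [h0, Scheme.basicOpen_zero] at hz'
    exact hz'
  exact (basicOpen_eq_bot_iff w).1 hbot

/-- **Global functions on `A` are determined by their restriction along the unit section** (`T` reduced, locally Noetherian).
[cite: MumfordFogartyKirwan1994, Ch. 6 §1 Proposition 6.1 (pp. 115–116)] -/
theorem appTop_eq_of_unitSection_appTop_eq (u v : Γ(A.X.left, ⊤)) (h : A.unitSection.appTop u = A.unitSection.appTop v) :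
    u = v :=
  sub_eq_zero.1 (A.appTop_eq_zero_of_unitSection_appTop_eq_zero (u - v) (by rw [map_sub, h, sub_self]))

/-- **Every global function on `A` is the pull-back of its restriction along the unit section**: `w = p^♯(ε^♯ w)`.
[cite: MumfordFogartyKirwan1994, Ch. 6 §1 Proposition 6.1 (pp. 115–116)] [cite: MumfordAV1970, §5 Cor. 6 (p. 54)] -/
theorem eq_appTop_unitSection_appTop (w : Γ(A.X.left, ⊤)) : w = A.X.hom.appTop (A.unitSection.appTop w) := by
  refine A.appTop_eq_of_unitSection_appTop_eq _ _ ?_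
  rw [← CommRingCat.comp_apply A.X.hom.appTop, ← Scheme.Hom.comp_appTop, A.unitSection_comp_hom, Scheme.Hom.id_appTop]
  rfl

/-- **`Γ(A, 𝒪_A) = Γ(T, 𝒪_T)` for an abelian scheme over a REDUCED locally Noetherian base** (the Stein property of `A → T`
on global sections): `p^♯ : Γ(T, 𝒪) → Γ(A, 𝒪)` is bijective, with inverse `ε^♯`. [cite: MumfordAV1970, §5 Cor. 6 (p. 54)]
[cite: MumfordFogartyKirwan1994, Ch. 6 §1 Proposition 6.1 (pp. 115–116)] -/
theorem appTop_hom_bijective : Function.Bijective A.X.hom.appTop := by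
  have hret : ∀ a : Γ(T, ⊤), A.unitSection.appTop (A.X.hom.appTop a) = a := fun a => by
    rw [← CommRingCat.comp_apply A.X.hom.appTop, ← Scheme.Hom.comp_appTop, A.unitSection_comp_hom, Scheme.Hom.id_appTop]
    rfl
  refine ⟨fun a b hab => ?_, fun w => ⟨A.unitSection.appTop w, (A.eq_appTop_unitSection_appTop w).symm⟩⟩
  rw [← hret a, ← hret b]
  exact congrArg _ hab

/-! ## §2 Rigidified endomorphisms and isomorphisms of line bundles on `A` -/

variable {A}

/-- **An endomorphism of a line bundle on `A` whose restriction along the unit section is the identity IS the identity**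
(`T` reduced, locally Noetherian): `α = a · 𝟙` for a global function `a` (★ `exists_unique_eq_globalScalar`), `ε^*α =
ε^♯(a) · 𝟙 = 𝟙` forces `ε^♯ a = 1 = ε^♯ 1` (★ `pullback_map_globalScalar`, ★ `eq_of_globalScalar_eq`), hence `a = 1` (§1).
[cite: Hartshorne1977, II Ex. 5.1 (b) (p. 123)] [cite: MumfordAV1970, §13 (p. 125)] -/
theorem eq_id_of_pullback_unitSection_map_eq_id {E : A.X.left.Modules} (h₁ : HasRank E 1) (α : E ⟶ E)
    (h : (Scheme.Modules.pullback A.unitSection).map α = 𝟙 _) : α = 𝟙 E := by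
  obtain ⟨a, ha, -⟩ := exists_unique_eq_globalScalar h₁ α
  rw [ha] at h ⊢
  rw [pullback_map_globalScalar, ← globalScalar_one] at h
  have ha1 : A.unitSection.appTop a = A.unitSection.appTop 1 :=
    (eq_of_globalScalar_eq Nat.one_pos (hasRank_pullback _ h₁) h).trans (map_one _).symm
  rw [A.appTop_eq_of_unitSection_appTop_eq a 1 ha1, globalScalar_one]

/-- **Two morphisms of line bundles `E → E′` on `A`, the second an isomorphism, with the same restriction along the unit
section are equal** (`T` reduced, locally Noetherian): apply `eq_id_of_pullback_unitSection_map_eq_id` to `α ≫ β⁻¹`.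
[cite: MumfordAV1970, §13 (p. 125)] [cite: MilneAV2008, I §8 pp. 36–37] -/
theorem hom_eq_of_pullback_unitSection_map_eq {E E' : A.X.left.Modules} (h₁ : HasRank E 1) (α β : E ⟶ E') [IsIso β]
    (h : (Scheme.Modules.pullback A.unitSection).map α = (Scheme.Modules.pullback A.unitSection).map β) : α = β := by
  have hid : α ≫ inv β = 𝟙 E := by
    refine eq_id_of_pullback_unitSection_map_eq_id h₁ (α ≫ inv β) ?_
    rw [Functor.map_comp, h, ← Functor.map_comp, IsIso.hom_inv_id]
    exact (Scheme.Modules.pullback A.unitSection).map_id E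
  simpa only [Category.assoc, IsIso.inv_hom_id, Category.comp_id, Category.id_comp] using congrArg (· ≫ β) hid

/-- **A RIGIDIFIED AUTOMORPHISM of a line bundle on `A` is the identity** (`Iso` form of
`eq_id_of_pullback_unitSection_map_eq_id`). [cite: MumfordAV1970, §13 (p. 125)] [cite: MilneAV2008, I §8 pp. 36–37] -/
theorem iso_eq_refl_of_pullback_unitSection_map_eq_id {E : A.X.left.Modules} (h₁ : HasRank E 1) (α : E ≅ E)
    (h : (Scheme.Modules.pullback A.unitSection).map α.hom = 𝟙 _) : α = Iso.refl E :=
  Iso.ext (eq_id_of_pullback_unitSection_map_eq_id h₁ α.hom h)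

/-- **RIGIDIFIED ISOMORPHISMS of line bundles on `A` ARE UNIQUE over a reduced base**: two isomorphisms `E ≅ E′` with the
same restriction along the unit section coincide. [cite: MumfordAV1970, §13 (p. 125)] [cite: MilneAV2008, I §8 pp. 36–37] -/
theorem iso_eq_of_pullback_unitSection_map_eq {E E' : A.X.left.Modules} (h₁ : HasRank E 1) (α β : E ≅ E')
    (h : (Scheme.Modules.pullback A.unitSection).map α.hom = (Scheme.Modules.pullback A.unitSection).map β.hom) :
    α = β :=
  Iso.ext (hom_eq_of_pullback_unitSection_map_eq h₁ α.hom β.hom h)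

/-- The same uniqueness for RIGIDIFIED LINE BUNDLES in the tree's currency (★ `RigidifiedLineBundle`, base-changed abelian
scheme `B_T = B.baseChange f` over the reduced `T`, unit section `ε_T = (B.baseChange f).unitSection`): two isomorphisms
`ℒ₁.L ≅ ℒ₂.L` whose restrictions along `ε_T` agree are equal. [cite: MilneAV2008, I §8 pp. 36–37] [cite: MumfordAV1970, §13 (p. 125)] -/
theorem RigidifiedLineBundle.iso_eq_of_pullback_unitSection_map_eq {S : Scheme.{u}} {B : AbelianSchemeOver S}
    {f : T ⟶ S} (ℒ₁ ℒ₂ : B.RigidifiedLineBundle f) (α β : ℒ₁.L ≅ ℒ₂.L)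
    (h : (Scheme.Modules.pullback (B.baseChange f).unitSection).map α.hom =
      (Scheme.Modules.pullback (B.baseChange f).unitSection).map β.hom) : α = β :=
  AbelianSchemeOver.iso_eq_of_pullback_unitSection_map_eq ℒ₁.hasRank_one α β h

end AbelianSchemeOver

end Literature.AlgebraicGeometry.AbelianSchemes

end
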